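import Summits.HodgeConjecture.HodgeConjecture.Theses.AnchorTransport
import Literature.AlgebraicGeometry.HodgeTheory.GysinFormalismCorrespondences

/-!
# Crux VariationalHodge (stmt-HodgeConjecture-1076) — ideator 1, round 1: first lemmas

Two idea cards (`tame-symbol-splitting`, `gw-section-transport`); the statements below are the
first checkable statements of each line, typed over the tree's real carriers. Nothing here is a
route item; `sorry`-free (statements are `def … : Prop`, plus trivial sanity theorems).
-/

namespace Summit.HodgeConjecture.HodgeConjecture.Cruxes.VariationalHodge.IdeatorOne

open CategoryTheory AlgebraicGeometry MonoidalCategory CartesianMonoidalCategory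
open Literature.AlgebraicGeometry Literature.AlgebraicGeometry.Motives
  Literature.AlgebraicGeometry.HodgeTheory

/-- The crux, abbreviated. -/
abbrev V : Prop := Summit.HodgeConjecture.HodgeConjecture.Theses.AnchorTransport.VariationalHodge

/-! ## Card `tame-symbol-splitting`, first lemma: reduction to ONE-DIMENSIONAL bases

VHC for smooth irreducible bases of (topological Krull) dimension `1` implies VHC: join `s₀` to
`s` by an irreducible curve in `S`, normalise it (smooth, irreducible), pull the family and the
global class back (`Motives.familyPullback`), and read the conclusion at a point over `s`.
The tame-symbol line then works over the discrete valuation ring `𝒪_{C,s₀}` of that curve. -/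

/-- VHC restricted to base schemes of topological Krull dimension `1` (smooth irreducible
complex CURVES). Same body as `AnchorTransport.VariationalHodge` with one extra hypothesis. -/
def VariationalHodgeCurveBase : Prop :=
  ∀ ⦃n : ℕ⦄ ⦃𝒳 S : SchemeOver ℂ⦄ (f : 𝒳 ⟶ S), IsSmoothProjectiveFamily f n →
    IrreducibleSpace S.left → AlgebraicGeometry.Smooth S.hom →
    topologicalKrullDim S.left = 1 →
    ∀ (p : ℕ) (A : complexBetti 𝒳 (2 * p)),
      (∀ s : ComplexPoints S, IsRationalClass (complexBetti.map (fiberι f s) (2 * p) A) ∧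
        IsOfHodgeType n (fiberOver f s) (2 * p) p p (complexBetti.map (fiberι f s) (2 * p) A)) →
      (∃ s₀ : ComplexPoints S,
        complexBetti.map (fiberι f s₀) (2 * p) A ∈ algebraicClasses (fiberOver f s₀) p) →
      ∀ s : ComplexPoints S,
        complexBetti.map (fiberι f s) (2 * p) A ∈ algebraicClasses (fiberOver f s) p

/-- FIRST LEMMA (card `tame-symbol-splitting`): curve bases suffice. Content: any two complex
points of a smooth irreducible quasi-projective `S` lie on an irreducible curve; normalisation is
smooth irreducible of dimension `1`; `familyPullback` preserves `IsSmoothProjectiveFamily`,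
fibres (`fiberOverFamilyPullbackIso`) and global classes. M-sized, provable with the tree's
base-change API plus a Bertini/curve-through-two-points fact. -/
def CurveBaseReduction : Prop := VariationalHodgeCurveBase → V

/-- Sanity (the trivial direction typechecks against the route decl verbatim). -/
theorem curveBase_of_V (h : V) : VariationalHodgeCurveBase :=
  fun _ _ _ f hf hirr hsm _ p A hA hanch s => h f hf hirr hsm p A hA hanch s

/-- CLOSING LEMMA shared by both cards (σ-closedness of the algebraicity locus, Voisin 2007 §0 /
Charles–Schnell Prop. 11.3.11, tree `voisin2007_algebraicityLocus_iUnion_qbarClosed` for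
`ℚ̄`-families): if the fibre classes of a global class are algebraic on a set `Λ ⊆ S(ℂ)` that is
NOT contained in a countable union of proper Zariski-closed-on-points subsets, they are algebraic
everywhere. (For the tame-symbol line `Λ` = complex points over a Zariski-dense open; for the
GW line `Λ` = image of a dominant family.) -/
def ClosingFromThickSet : Prop :=
  ∀ ⦃n : ℕ⦄ ⦃𝒳 S : SchemeOver ℂ⦄ (f : 𝒳 ⟶ S), IsSmoothProjectiveFamily f n →
    IrreducibleSpace S.left →
    ∀ (p : ℕ) (A : complexBetti 𝒳 (2 * p)) (Λ : Set (ComplexPoints S)),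
      (∀ Z : ℕ → Set (ComplexPoints S), (∀ k, IsZariskiClosedOnPoints S (Z k)) →
        (∀ k, Z k ≠ Set.univ) → ¬ Λ ⊆ ⋃ k, Z k) →
      (∀ s ∈ Λ, complexBetti.map (fiberι f s) (2 * p) A ∈ algebraicClasses (fiberOver f s) p) →
      ∀ s : ComplexPoints S,
        complexBetti.map (fiberι f s) (2 * p) A ∈ algebraicClasses (fiberOver f s) p

/-! ## Card `gw-section-transport`, first lemma: transport by a flat family of algebraic
correspondences from the anchor fibre (Gram–Cayley–Hamilton form, simplest case `E A₀ = A₀`)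

`γ t ∈ H^{2n}((X_t ⊗ X_{s₀})(ℂ))` is a family of correspondence classes from the anchor fibre
`X_{s₀}` to the fibres `X_t` (in the intended instance: the fibre-restrictions of the class of ONE
algebraic cycle `T` on `X_{s₀} × 𝒳`, e.g. the two-point section-class Gromov–Witten
correspondence, or the section-transport graph of a covering family of sections); the receiver is
the FIRST factor (`GysinFormalism.corrClassGen` convention). Hypotheses: each `γ t` acts
algebraically (`halg`; for cycle classes this is `corrActGen_mem_algebraicClasses`), the
transported anchor class glues to a global class `Gl` on `𝒳` (`hglue`; automatic for the
restrictions of a cycle on `X_{s₀} × 𝒳` by base change for the proper projection), and the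
anchor correspondence fixes `A|_{X_{s₀}}` (`hfix`, the "anchor coefficient" condition in its
simplest form). Conclusion: VHC for this `(f, A, s₀)`. Proof (provable now): `Gl|_{X_{s₀}} =
A|_{X_{s₀}}`, two global classes agreeing on one fibre agree on all fibres of the irreducible `S`
(`transportFun_map_fiberι` + path-connectedness of `S(ℂ)`), and `Gl|_{X_t} = (γ t)^*(A|_{s₀})`
is algebraic by `halg`. -/
def CorrespondenceTransport (G : GysinFormalism) : Prop :=
  ∀ ⦃n : ℕ⦄ ⦃𝒳 S : SchemeOver ℂ⦄ (f : 𝒳 ⟶ S) (hf : IsSmoothProjectiveFamily f n),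
    IrreducibleSpace S.left → AlgebraicGeometry.Smooth S.hom →
    ∀ (p : ℕ) (A : complexBetti 𝒳 (2 * p)) (s₀ : ComplexPoints S)
      (γ : ∀ t : ComplexPoints S, complexBetti (fiberOver f t ⊗ fiberOver f s₀) (2 * n)),
      -- each γ t sends algebraic classes of the anchor fibre to algebraic classes of X_t
      (∀ (t : ComplexPoints S) (c : complexBetti (fiberOver f s₀) (2 * p)),
        c ∈ algebraicClasses (fiberOver f s₀) p →
          G.corrClassGen (hf.isSmoothProjective t) (hf.isSmoothProjective s₀)
            (rfl : 2 * p + 2 * n = 2 * p + 2 * n) (γ t) c ∈ algebraicClasses (fiberOver f t) p) →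
      -- the transported anchor class is the restriction of ONE global class (flatness)
      (∃ Gl : complexBetti 𝒳 (2 * p), ∀ t : ComplexPoints S,
        G.corrClassGen (hf.isSmoothProjective t) (hf.isSmoothProjective s₀)
            (rfl : 2 * p + 2 * n = 2 * p + 2 * n) (γ t)
            (complexBetti.map (fiberι f s₀) (2 * p) A) =
          complexBetti.map (fiberι f t) (2 * p) Gl) →
      -- anchor coefficient condition (simplest form): γ_{s₀} fixes A|_{s₀}
      G.corrClassGen (hf.isSmoothProjective s₀) (hf.isSmoothProjective s₀)
          (rfl : 2 * p + 2 * n = 2 * p + 2 * n) (γ s₀)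
          (complexBetti.map (fiberι f s₀) (2 * p) A) =
        complexBetti.map (fiberι f s₀) (2 * p) A →
      complexBetti.map (fiberι f s₀) (2 * p) A ∈ algebraicClasses (fiberOver f s₀) p →
      ∀ t : ComplexPoints S,
        complexBetti.map (fiberι f t) (2 * p) A ∈ algebraicClasses (fiberOver f t) p

end Summit.HodgeConjecture.HodgeConjecture.Cruxes.VariationalHodge.IdeatorOne
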